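import Literature.NumberTheory.EllipticCurves.CastellaGrossiLeeSkinner2022.HowardDivisibilityAnyClassNumber
import HarnessLib

/-!
# Castella–Grossi–Skinner 2025, Theorem 6.5.2 at ANY class number of `K`: the Heegner-point
# Kolyvagin bound `char_Λ(M) ∣ char_Λ(𝔖_ord/Λκ₁^{Hg})` in `Λ[1/p]` — NO localisation at `(γ - 1)`, NO
# Selmer-corank hypothesis — stated with the `d(k)`-shifted stabilised class module `Λκ₁^{Hg} = Λκ_∞`

Topic `NumberTheory/EllipticCurves`. ONE named fact (`def … : Prop`, D-0014; nothing asserted) and its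
kernel bookkeeping. It is the «general form» left as `TODO(general form)` next to the tree's
`CastellaGrossiSkinner2025.thm652_rankOne_charIdeal_torsion_eq_sq_dvd`
(`AnticyclotomicMainConjectures.lean`): that declaration types the SAME printed theorem in the
`HeegnerFamily` / `heegnerModule D F` vocabulary of Howard 2004 Thm. 3.3.7 and therefore carries the EXTRA,
NOT PRINTED binder `p ∤ h_K`; since 2026-08-28 the tree has the printed object at every class number —
the `d(k)`-shifted `α`-stabilised Heegner datum `CastellaGrossiLeeSkinner2022.StabilizedHeegnerData` with
its class module `stabilizedHeegnerModule D C = Λκ_∞ = Λκ₁^{Hg}` (CGLS 2022 Rem. 4.1.4: "`κ_∞` and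
`κ₁^{Hg}` generate the same `Λ`-submodule") and `stabilizedHeegnerCharIdeal D C = char_Λ(𝔖/Λκ₁^{Hg})`, in
which the sibling fact `CastellaGrossiLeeSkinner2022.thm413_rankOne_charIdeal_torsion_dvd_localized`
(Invent. Math. 227 Thm. 4.1.3: the same bound in `Λ[1/p, 1/(γ-1)]`, in `Λ[1/p]` only at corank one) is
already typed. This file records Math. Ann. 393 Thm. 6.5.2 in exactly that shape, under exactly that
hypothesis record (`Thm413Hypotheses`); the companion `HeegnerKolyvaginBoundAnyClassNumberProofs.lean`
PROVES that it implies the typed Thm. 4.1.3 (`thm413_of_thm652_stabilized`) — the kernel check that the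
new fact is the stronger statement and adds no hypothesis — and the containment shapes consumers use.
STATEMENT ONLY here. Cell `bsd-print-x9` (D-0131 (2) PRINT TIER), seat `bsd-line-x10b-p2` (LEAD of crux
stmt-BirchSwinnertonDyer-23729 `PrintX10b.HowardContainmentAnyClassNumberX10b`), 2026-08-28: the consumer is
the `(γ - 1)`-part of Howard's containment on X10b Heegner frames WITHOUT a rank-one binder (crux 23729
as filed; line `mu-isolation-x10b` stub `stub_pLocalizedContainment`), where Thm. 4.1.3's "Moreover"
clause is unavailable; offered by seat `lit` g19 (2026-08-28T02:13Z: «its general form = the same statement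
with `StabilizedHeegnerData`»). HONEST FRAMING: typed ≠ proved ≠ endorsed; nothing here moves a class;
BSD is not proved by any of this.

## The printed statements, verbatim (final TeX `Mazur-paper_revised.tex`; v1 = `paper:arxiv-2303.04373`)

* **§6 standing** [l.2259–2262; v1 §5, p0020 L9–L13]: "Throughout this section, we let `E/ℚ` be an
  elliptic curve of conductor `N`, `p ∤ 2N` be a prime of good ordinary reduction for `E`, and `K` be an
  imaginary quadratic field of discriminant `D_K` prime to `Np`. We assume that (h1) `E(K)[p] = 0`."
* **§6.5 identifications** [l.3203–3211; v1 §5.5, p0026 L36–L42]: "Let `Λ = Λ_K⁻`, and note that the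
  modules `𝒳 = H¹_{𝓕_Λ}(K, M_E)^∨`, `H¹_{𝓕_Λ}(K, 𝐓)` in [CGLS22, §3.4] are the same as the modules
  `𝔛_ord(E/K_∞⁻)` and `𝔖_ord(E/K_∞⁻)` in §3.1, respectively."
* **Theorem 6.5.1** (`thm:howard`) [l.3213–3220]: "Assume `E(K)[p] = 0` and suppose there is a Kolyvagin
  system `κ ∈ 𝐊𝐒(𝐓, 𝓕_Λ, 𝓛_E)` with `κ₁ ≠ 0`. Then `𝔖_ord(E/K_∞⁻)` has `Λ`-rank one, and there is a
  finitely generated torsion `Λ`-module `M` such that (i) `𝔛_ord(E/K_∞⁻) ∼ Λ ⊕ M ⊕ M`, (ii) `char_Λ(M)`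
  divides `char_Λ(𝔖_ord(E/K_∞⁻)/Λκ₁)` in `Λ[1/p]`." Proof [l.3221–3227]: "The proof is the same as that
  of [CGLS22, Theorem 3.4.1]. However, the height one prime `(γ⁻ - 1) ⊂ Λ` was excluded from the analysis
  in loc. cit. … Replacing the appeal to op. cit. with one to Theorem 6.1.1 for the case of the prime
  `(γ⁻ - 1)`, yields the theorem."
* **Lead-in** [l.3229]: "Applying Theorem 6.5.1 to the Kolyvagin system `κ^{Hg} = {κ_n^{Hg}}_{n ∈ 𝒩}` of
  [CGLS22, Thm. 4.1.1], we thus obtain the following." — [CGLS22] Thm. 4.1.1 is stated under the §4.1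
  standing hypotheses of that paper, "(Heeg) and (disc)" (arXiv:2008.02571v2 TeX L2186), and its proof
  covers `p ∣ h_K` ("`P_k[n] := Norm_{K[np^{d(k)}]/K_k[n]}(P[np^{d(k)}])`, `d(k) = min{d : K_k ⊂ K[p^d]}` …
  the arguments … apply almost verbatim in the case when `p` divides the class number of `K`", L2213–2246).
* **Theorem 6.5.2** (`thm:howard-HP`) [l.3232–3238; v1 Thm. 5.5.2, p0026 L45–L52]: "Assume `E(K)[p] = 0`.
  Then `𝔖_ord(E/K_∞⁻)` has `Λ`-rank one, and there is a finitely generated torsion `Λ`-module `M` such that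
  (i) `𝔛_ord(E/K_∞⁻) ∼ Λ ⊕ M ⊕ M`, (ii) `char_Λ(M)` divides `char_Λ(𝔖_ord(E/K_∞⁻)/Λκ₁^{Hg})` in `Λ[1/p]`."

NO hypothesis on the class number of `K`, on the image of `E[p]` beyond (h1), on the splitting of `p` in
`K`, on parity, or on the Selmer corank appears in §6–§6.5 or in [CGLS22] §4.1.

## Transcription (weaker than print, never stronger) — INHERITED, nothing re-decided

Word for word the transcription of the sibling `CastellaGrossiLeeSkinner2022.thm413_…` (module docstring of
`HowardDivisibilityAnyClassNumber.lean`): `𝔖_ord(E/K_∞⁻) = H¹_{𝓕_Λ}(K, 𝐓)` is a `LambdaAdicSelmerData` `D`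
(`D.S`), `𝔛_ord(E/K_∞⁻) = 𝒳` a `SelmerDualData` `X` (`X.X`), `Λκ₁^{Hg} = Λκ_∞` the class module
`stabilizedHeegnerModule D C` of a `StabilizedHeegnerData` `C` at level `N = N_E`, so that
`char_Λ(𝔖_ord/Λκ₁^{Hg}) = stabilizedHeegnerCharIdeal D C`; `𝔛 ∼ Λ ⊕ M ⊕ M` is recorded through the
invariants `rank_Λ 𝔛 = 1` and `char_Λ(𝔛_{Λ-tors}) = char_Λ(M)²`; "divides in `Λ[1/p]`" as "divides
`(p^m)·(–)` in `Λ` for some `m`" (principal ideals of the UFD `Λ`); torsion-freeness of `𝔖` is NOT asserted.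
Hypotheses = the §6 standing hypotheses + the (Heeg), (disc) standing of [CGLS22] Thm. 4.1.1 (where `κ^{Hg}`
is built) + `κ` anticyclotomic with topological generator `γ` = the record
`CastellaGrossiLeeSkinner2022.Thm413Hypotheses` FIELD BY FIELD (it was typed as "§3.2 + §4.1 standing of
CGLS 2022" = the §6 standing here; no `p ∤ h_K`, no image, no corank). Provenance flag for consumers'
docstrings: `CGS25-6.5.2@CGLS22-4.1.1(How04-2.3.4-almost-verbatim+CornutVatsal)` — the Kolyvagin system at
`p ∣ h_K` is printed in [CGLS22] as an "almost verbatim" adaptation of Howard's Lemma 2.3.4, `κ₁^{Hg} ≠ 0`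
by Cornut–Vatsal; Thm. 6.5.2's own proof is §6 of the refereed paper (no Beilinson–Flach input).

Relation to the tree's special case: `CastellaGrossiSkinner2025.thm652_rankOne_charIdeal_torsion_eq_sq_dvd`
(under `Thm652Hypotheses`, i.e. with `p ∤ h_K`, for `heegnerModule D F`) is the same printed theorem read
through Howard's generation theorem `ℋ_F = Λκ₁` (Thm. 3.3.7, `p ∤ h_K`); relating the two typed shapes is
the envelope comparison `ℋ_F` vs `Λκ_∞(C)` of the cell's line stubs (a prover's step), not asserted here.

## References

* [CastellaGrossiSkinner2025] F. Castella, G. Grossi, C. Skinner, *Mazur's main conjecture at Eisenstein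
  primes*, Math. Ann. **393** (2025) 2451–2506 = arXiv:2303.04373v2: §6 standing hypotheses (final TeX
  l.2259–2262), §6.5 (l.3201–3211), Thm. 6.5.1 (l.3213–3227), Thm. 6.5.2 (l.3229–3238); v1 numbering
  5.5.1 / 5.5.2 (`paper:arxiv-2303.04373` p0026).
* [CastellaGrossiLeeSkinner2022] Invent. Math. **227** (2022) 517–580 = arXiv:2008.02571v2: §3.2 standing
  (L1253–1262), §4.1 standing + Thm. 4.1.1 (L2186–2249), Rem. 4.1.4 (L2262–2294: `κ_∞`, "generate the
  same `Λ`-submodule").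
* [Howard2004HeegnerKolyvagin] Compositio Math. **140** (2004), Thm. B and Lemma 2.3.4 (journal numbering;
  the construction adapted).
-/

noncomputable section

open scoped Classical

universe u

namespace Literature.NumberTheory.EllipticCurves.CastellaGrossiSkinner2025

open WeierstrassCurve Literature.NumberTheory.EllipticCurves
  Literature.NumberTheory.EllipticCurves.CastellaGrossiLeeSkinner2022

/-! ### 1. Theorem 6.5.2 as a named fact, ANY class number (shape of `thm413_…`, minus `(γ - 1)`) -/

/-- **Castella–Grossi–Skinner, Math. Ann. 393 (2025) 2451–2506 = arXiv:2303.04373v2, Theorem 6.5.2**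
(`thm:howard-HP`, final TeX l.3232–3238; v1 Thm. 5.5.2), verbatim: "Assume `E(K)[p] = 0`. Then
`𝔖_ord(E/K_∞⁻)` has `Λ`-rank one, and there is a finitely generated torsion `Λ`-module `M` such that
(i) `𝔛_ord(E/K_∞⁻) ∼ Λ ⊕ M ⊕ M`, (ii) `char_Λ(M)` divides `char_Λ(𝔖_ord(E/K_∞⁻)/Λκ₁^{Hg})` in `Λ[1/p]`"
— obtained (l.3229) by "applying Theorem 6.5.1 to the Kolyvagin system `κ^{Hg}` of [CGLS22, Thm. 4.1.1]",
under the §6 standing hypotheses (l.2259–2262: `E/ℚ` of conductor `N`, `p ∤ 2N` good ordinary, `K`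
imaginary quadratic with `D_K` prime to `Np`, (h1) `E(K)[p] = 0`) and the (Heeg), (disc) standing of
[CGLS22] §4.1 under which `κ^{Hg}` is built at EVERY class number of `K` (arXiv:2008.02571v2 TeX
L2186, L2213–2246) — i.e. under the record `CastellaGrossiLeeSkinner2022.Thm413Hypotheses`, with NO
`p ∤ h_K`, NO Galois-image hypothesis beyond (h1), NO Selmer-corank hypothesis. Here `Λκ₁^{Hg} = Λκ_∞` is
the `d(k)`-shifted `α`-stabilised class module of [CGLS22] Rem. 4.1.4 (`stabilizedHeegnerModule D C`, so
`char_Λ(𝔖_ord/Λκ₁^{Hg}) = stabilizedHeegnerCharIdeal D C`). Recorded, for every `Λ`-adic Selmer datum `D`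
(`𝔖_ord`), stabilised Heegner datum `C` at level `N` and Selmer-dual datum `X` (`𝔛_ord`), through
invariants of the printed pseudo-isomorphism (WEAKER, never stronger): `D.S` and `X.X` finitely generated
of `Λ`-rank one, and there are an ideal `J ⊆ Λ` (`= char_Λ(M)`) and `m ∈ ℕ` with `char_Λ(𝔛_{Λ-tors}) = J²`
((i)) and `J ∣ (p^m)·I(Λκ_∞)` ((ii)). = the tree's `thm413_rankOne_charIdeal_torsion_dvd_localized` with the
localisation at `(γ - 1)` REMOVED at every corank (`thm413_of_thm652_stabilized` below); = the tree's
`thm652_rankOne_charIdeal_torsion_eq_sq_dvd` WITHOUT its extra `p ∤ h_K` (its `TODO(general form)`), in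
the stabilised-class currency. PUBLISHED THEOREM (proof: §6 of the paper + [CGLS22] §3–§4 + Howard +
Cornut–Vatsal; no Beilinson–Flach classes); provenance flag
`CGS25-6.5.2@CGLS22-4.1.1(How04-2.3.4-almost-verbatim+CornutVatsal)`. A `Prop`; nothing asserted.
[cite: CastellaGrossiSkinner2025, Thm. 6.5.2 (final TeX `thm:howard-HP` l.3229–3238; v1 Thm. 5.5.2) with Thm. 6.5.1 (l.3213–3227), §6 standing hypotheses (l.2259–2262) and §6.5 identifications (l.3201–3211)]
[cite: CastellaGrossiLeeSkinner2022, Thm. 4.1.1 (the Kolyvagin system κ^{Hg} at any class number, arXiv v2 TeX L2203–2249) and Rem. 4.1.4 (Λκ_∞ = Λκ₁^{Hg}, L2262–2294); §4.1 standing (Heeg), (disc) (L2186)]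
[cite: Howard2004HeegnerKolyvagin, Thm. B (the shape) and Lemma 2.3.4 (the construction adapted)] -/
def thm652_stabilized_rankOne_charIdeal_torsion_dvd_pLocalized : Prop :=
  ∀ (N : ℕ) [NeZero N] (W : WeierstrassCurve ℚ) [W.IsGloballyMinimal]
    (K : Type u) [Field K] [NumberField K] (p : ℕ) [Fact p.Prime] (κ : ZpExtension K p)
    (γ : Field.absoluteGaloisGroup K) (jbar : AlgebraicClosure K →+* ℂ),
    Thm413Hypotheses N W K p κ γ →
    ∀ (D : (W.baseChange K).LambdaAdicSelmerData κ γ) (C : StabilizedHeegnerData N W K κ jbar)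
      (X : (W.baseChange K).SelmerDualData κ γ),
      (Module.Finite (IwasawaAlgebra p) D.S ∧ Module.finrank (IwasawaAlgebra p) D.S = 1) ∧
      (Module.Finite (IwasawaAlgebra p) X.X ∧ Module.finrank (IwasawaAlgebra p) X.X = 1 ∧
        ∃ (J : Ideal (IwasawaAlgebra p)) (m : ℕ),
          Module.charIdeal (IwasawaAlgebra p) (Submodule.torsion (IwasawaAlgebra p) X.X) = J ^ 2 ∧
          J ∣ Ideal.span {(p : IwasawaAlgebra p) ^ m} * stabilizedHeegnerCharIdeal D C)

end Literature.NumberTheory.EllipticCurves.CastellaGrossiSkinner2025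

end
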